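import Summits.ValiantsHypothesis.ValiantsHypothesis.Theorems.KPlusLogSqLawTropicalBThreeFiveTreeD2
import Summits.ValiantsHypothesis.ValiantsHypothesis.Theorems.KPlusLogSqLawTropicalBNormalForm
import Summits.ValiantsHypothesis.ValiantsHypothesis.Theorems.KPlusLogSqLawTropicalBTightnessThreshold

/-!
# Route «KPlusLogSqLaw», crux `TropicalB` (stmt-ValiantsHypothesis-19771) — THE UNSIGNED `(3,5)` ROW `TropRowD 3 5 33` AND THE
# COUNTING-TIGHTNESS THRESHOLD OF SIZE THREE: `κ(3) = 4` (the `3 × 3` formats carrying a dominant chain through ALL class multisets are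
# exactly `2 ≤ K ≤ 4`)

HONEST FRAMING.  Helper / census theorem toward the registered stubs `stub_tropThin` / `stub_tropFat` of `Cruxes/TropicalB/Lines/birth.lean`
(crux `Summit.ValiantsHypothesis.ValiantsHypothesis.Theses.KPlusLogSqLaw.TropicalB`, item stmt-ValiantsHypothesis-19771; cell `pub-symmetroid`,
seat val-sym-trop-p3 g10, 2026-08-28; `--supports … --as helper`).  A SMALL-FORMAT census value (`m = 3`, `K = 5`) and the structure register it
closes, far inside the crux's known regime; nothing here bears on `TropicalB` in its window, `WeakLifting`, DoorA26 / DoorA34, `MatrixDescartes`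
(stmt-ValiantsHypothesis-18050) or VP ≠ VNP.

THEOREMS.
* `ThreeFive.tropRowD_three_five : TropRowD 3 5 33` — every chain of unique optima at strictly increasing integer slopes with CONSECUTIVE TERMS
  DISTINCT (no sign condition, no `|ε| ≤ 1`), of any `3 × 3` dominance design with `5` slope classes and ANY exponent vector, has at most `33`
  breakpoints — one less than slope counting (`tropRowD_slopeCount`: `34 = C(7,3) − 1`).  Register before: SIGNED row `TropRootLawAt 3 5 33`
  (`ThreeFive.tropRootLawAt_three_five`, val-sym-trop-p4 g5, p501835); unsigned `≤ 33` located only (trop-p4 g5 memo; trop-p4 g12: 1397 of 1944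
  order types covered in the kernel by descent); lower side `T_D(3,5) ≥ 30`, `T(3,5) ≥ 30` (`…ThreeFiveThirtyOne`, this seat, 31 terms on `d = (0,4,11,21,30)`; before: 28,
  `…ThreeRowKFive`, val-sym-trop-p3 g9).  So `30 ≤ T_D(3,5) ≤ 33` in the kernel.
* (the signed row `ThreeFive.tropRootLawAt_three_five : TropRootLawAt 3 5 33`, p501835, is the special case `tropRootLawAt_of_tropRowD`.)
* `Tightness.three_row_tight_iff : 2 ≤ K → (¬ TropRowD 3 K (multichoose K 3 − 2) ↔ K ≤ 4)` — **`κ(3) = 4` IN THE KERNEL**: the size-3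
  formats that are counting-tight (some design has an unsigned dominant chain through all `C(K+2,3)` class multisets) are exactly `K = 2, 3, 4`
  (tight side: `Tightness.three_row_tight_of_le_four`, descent from `T(3,4) = 19`; non-tight side: this row at `K = 5` propagated to every
  `K ≥ 5` by `Tightness.tropRowD_notTight_mono`).  Register before: `κ(3) ∈ [4, 7]` kernel (`…TightnessCeiling`), `= 4` located.
  `Tightness.three_row_notTight_of_five_le` is the row form `5 ≤ K → TropRowD 3 K (multichoose K 3 − 2)`.

PROOF of the row.  If two classes carry the same exponent, the histograms `{a,a,a}` and `{b,b,b}` have equal slope and an unsigned chain (slopes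
strictly increasing, `existsD_pos_of_ge`) misses one of them (`leD_33_of_tie₃'`).  Otherwise `d` is injective: relabel the classes by the sorting
permutation `Tuple.sort d` (`chain_relabel_classes`, val-sym-trop-p3; dominance and distinctness of consecutive terms are preserved), so that the
exponents are strictly increasing, and apply the unsigned decision tree `ThreeFive.treeD` (`…ThreeFiveTreeD1/1B/2`: 88 leaves over trichotomies of
slope comparisons, `=` leaves by the unsigned tie lemmas, strict leaves by the 61 unsigned certificates (`certD_*` of `…ThreeFiveCertD1/2/4/5/6`; the eleven of `…CertD3` inlined in the leaves), each a
kernel `decide` of val-sym-trop-p4 g5's order-type pairwise-law search `ThreeFive.search1`, sound by the cyclewise exchange law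
`sum_d_lt_of_isDominant_invariant` — which never used signs).  [this cell; the certificates and the tree are val-sym-trop-p4 g5's, re-run on the
unsigned wrapper `leD_33_of_search1` of `…ThreeFiveBoundD`]
-/

-- `Summit.ValiantsHypothesis.ValiantsHypothesis.…` repeats a component by the D-0017 layout
-- (single-conjunct summit), which the `dupNamespace` linter flags; the name is mandated.
set_option linter.dupNamespace false
set_option autoImplicit false

namespace Summit.ValiantsHypothesis.ValiantsHypothesis.Theorems.KPlusLogSqLaw

open Summit.ValiantsHypothesis.ValiantsHypothesis.Theorems.MatrixDescartes.Negative
open Summit.ValiantsHypothesis.ValiantsHypothesis.Theorems.LacunarySymmetroidMatrixDescartes.TropicalCensus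
open Finset ForbiddenPatterns

namespace ThreeFive

/-- two constant histograms `{a,a,a} ≠ {b,b,b}` for distinct classes. -/
theorem triple_ne_triple {a b : Fin 5} (hab : a ≠ b) :
    (⟨{a, a, a}, by simp⟩ : Sym (Fin 5) 3) ≠ ⟨{b, b, b}, by simp⟩ := by
  intro h
  have hv : ({a, a, a} : Multiset (Fin 5)) = {b, b, b} := congrArg Subtype.val h
  have ha : a ∈ ({b, b, b} : Multiset (Fin 5)) := by rw [← hv]; simp
  simp only [Multiset.insert_eq_cons, Multiset.mem_cons, Multiset.mem_singleton, or_self] at ha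
  exact hab ha

/-- **THE UNSIGNED `(3,5)` ROW: `TropRowD 3 5 33`** — every dominant chain with consecutive terms distinct of a `(3,5)` design, for every
exponent vector, has at most `33` breakpoints (slope counting gives `34`; `(3,5)` is not counting-tight, unsigned).  [this cell] -/
theorem tropRowD_three_five : TropRowD 3 5 33 := by
  intro d v ε n θ p hθ hdom hne
  by_cases hinj : Function.Injective d
  · -- sort the classes: exponents become strictly increasing
    set π : Equiv.Perm (Fin 5) := Tuple.sort d with hπ
    have hmono : Monotone (d ∘ π) := by rw [hπ]; exact Tuple.monotone_sort d
    have hsm : StrictMono (d ∘ π) := hmono.strictMono_of_injective (hinj.comp π.injective)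
    obtain ⟨hdom', -⟩ := chain_relabel_classes π d v ε θ p hdom
    have hne' : ∀ k : Fin n,
        ((p k.castSucc).1, π.symm ∘ (p k.castSucc).2) ≠ ((p k.succ).1, π.symm ∘ (p k.succ).2) := by
      intro k h
      apply hne k
      have h1 := congrArg Prod.fst h
      have h2 := congrArg Prod.snd h
      refine Prod.ext h1 ?_
      funext i
      exact π.symm.injective (congrFun h2 i)
    exact treeD (d ∘ π) hsm _ _ n θ (fun k => ((p k).1, π.symm ∘ (p k).2)) hθ hdom' hne'
  · -- two classes with the same exponent: a slope tie between two constant histograms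
    have h' : ∃ a b, d a = d b ∧ a ≠ b := by
      by_contra hcon
      push Not at hcon
      exact hinj fun a b hab => hcon a b hab
    obtain ⟨a, b, hab, hne_ab⟩ := h'
    exact leD_33_of_tie₃' a a a b b b (triple_ne_triple hne_ab) d (by rw [hab]) v ε n θ p hθ hdom hne

/-- the unsigned row against slope counting: `33 = multichoose 5 3 − 2 < multichoose 5 3 − 1 = 34`. -/
theorem multichoose_five_three : Nat.multichoose 5 3 = 35 := by rw [Nat.multichoose_eq]; decide

end ThreeFive

namespace Tightness

/-- **`(3, K)` is NOT counting-tight for any `K ≥ 5`**: `TropRowD 3 K (multichoose K 3 − 2)` (the unsigned `(3,5)` row, propagated up in `K`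
by `tropRowD_notTight_mono`). -/
theorem three_row_notTight_of_five_le {K : ℕ} (hK : 5 ≤ K) : TropRowD 3 K (Nat.multichoose K 3 - 2) := by
  have h5 : TropRowD 3 5 (Nat.multichoose 5 3 - 2) := by
    rw [ThreeFive.multichoose_five_three]; exact ThreeFive.tropRowD_three_five
  exact tropRowD_notTight_mono (by norm_num) hK h5

/-- signed form: for `K ≥ 5` no SIGN-ALTERNATING dominant chain of a `3 × 3` design with `K` classes passes through all class multisets either
(`TropRootLawAt 3 K (multichoose K 3 − 2)`; the tree had this for `K ≥ 8` by halving, `Tightness.three_row_notTight`, and at `K = 5` signed). -/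
theorem tropRootLawAt_three_notTight_of_five_le {K : ℕ} (hK : 5 ≤ K) : TropRootLawAt 3 K (Nat.multichoose K 3 - 2) :=
  tropRootLawAt_of_tropRowD (three_row_notTight_of_five_le hK)

/-- **`κ(3) = 4` — THE SIZE-3 TIGHTNESS THRESHOLD IN THE KERNEL.**  For `K ≥ 2`, some `3 × 3` design with `K` slope classes has an (unsigned)
dominant chain through ALL `C(K+2, 3)` class multisets iff `K ≤ 4`.  (Tight side: descent from `T(3,4) = 19`, `three_row_tight_of_le_four`;
non-tight side: `three_row_notTight_of_five_le`.)  Register before: `κ(3) ∈ [4, 7]` kernel, `= 4` located. -/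
theorem three_row_tight_iff {K : ℕ} (hK : 2 ≤ K) : ¬ TropRowD 3 K (Nat.multichoose K 3 - 2) ↔ K ≤ 4 := by
  constructor
  · intro h
    by_contra h5
    push Not at h5
    exact h (three_row_notTight_of_five_le h5)
  · intro h4
    exact three_row_tight_of_le_four hK h4

end Tightness

end Summit.ValiantsHypothesis.ValiantsHypothesis.Theorems.KPlusLogSqLaw
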